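import Summits.RiemannHypothesis.RiemannHypothesis.Theses.ScrewQuarticNodes
import HarnessLib

/-!
# Route ScrewQuarticNodes (L22 «QUARTIC NODES») — support item `QuarticNodesDense` (stmt-RiemannHypothesis-22171)

By-name closer (rh-split typer-4 g0, row #0d). The block between the markers is rh-idea-9's folder proof
`pub/ideators/rh-idea-9/QuarticNodesDense.lean` (sha256 3acb30839ba2b5bb…, 63 l, Mathlib-only, rc 0 / 0 sorry at the desk)
VERBATIM except: (i) its `import Mathlib` line is dropped (the route-file import re-exports Mathlib), (ii) ONE docstring line
is inserted above `theorem quarticNodesDense_body` (gate `lint.docstring`), (iii) its namespace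
`…Theses.ScrewQuarticNodes.Folder` is renamed `…Theorems.ScrewQuarticNodes.Folder` (Theorems files declare under `Theorems`).
Then the one-line closer typed by the ROUTE DECL (the def body is the theorem's statement verbatim). RH-free elementary
real analysis (`T₀ = 0`, `j = ⌈e^{a/4}⌉₊`); nothing here bears on the truth of RH.
-/

-- D-0017: `Summit.RiemannHypothesis.RiemannHypothesis.…` duplicates the namespace BY DESIGN (single-problem summit).
set_option linter.dupNamespace false

-- ===== BEGIN rh-idea-9 QuarticNodesDense.lean (3acb30839ba2b5bb), minus `import Mathlib`, +1 docstring, namespace Theses→Theorems =====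

/-! # Folder proof of `ScrewQuarticNodes.QuarticNodesDense` (stmt-RiemannHypothesis-22171, support, provable-now)
rh-idea-9 g0, for typer-4 (director-rh 20:55:42Z «QuarticNodesDense 22171 → typer-4 queue on verbatim folder proof»).
The body below is VERBATIM the route decl's body (Theses/ScrewQuarticNodes.lean, `def QuarticNodesDense : Prop := …`); to land:
`import Summits.RiemannHypothesis.RiemannHypothesis.Theses.ScrewQuarticNodes` and
`theorem quarticNodesDense : Summit.RiemannHypothesis.RiemannHypothesis.Theses.ScrewQuarticNodes.QuarticNodesDense :=
  quarticNodesDense_body` (the def unfolds by `rfl`/`Iff.rfl`; or `by unfold …QuarticNodesDense; exact quarticNodesDense_body`).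
Mathematics: T₀ = 0, j = ⌈e^{a/4}⌉₊: a ≤ 4 log j ≤ 4 log(e^{a/4}+1) ≤ a + 4e^{−a/4}, and (4e^{−a/4})² = 16/e^{a/2} ≤ 100/(e·e^{a/2}+1)
since 16e + 16e^{−a/2} ≤ 16·2.72 + 16 < 100. Nothing here bears on the truth of RH. -/

namespace Summit.RiemannHypothesis.RiemannHypothesis.Theorems.ScrewQuarticNodes.Folder

/-- The body of `QuarticNodesDense`, verbatim (rh-idea-9 g0): `T₀ = 0`, `j = ⌈e^{a/4}⌉₊`. RH-free. -/
theorem quarticNodesDense_body :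
    ∃ T₀ : ℝ, ∀ a : ℝ, T₀ ≤ a → ∃ j : ℕ, 1 ≤ j ∧ a ≤ 4 * Real.log j ∧
      4 * Real.log j ≤ a + Real.sqrt (100 / (Real.exp ((a + 2) / 2) + 1)) := by
  refine ⟨0, fun a ha => ?_⟩
  set x : ℝ := Real.exp (a / 4) with hx
  have hx0 : 0 < x := Real.exp_pos _
  have hlogx : Real.log x = a / 4 := by rw [hx, Real.log_exp]
  have hx1 : 1 ≤ x := by
    rw [hx]; exact Real.one_le_exp (by linarith)
  refine ⟨⌈x⌉₊, ?_, ?_, ?_⟩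
  · exact Nat.ceil_pos.mpr hx0
  · have h1 : x ≤ (⌈x⌉₊ : ℝ) := Nat.le_ceil x
    have h2 : Real.log x ≤ Real.log (⌈x⌉₊ : ℝ) := Real.log_le_log hx0 h1
    linarith
  · -- 4 log ⌈x⌉₊ ≤ 4 log (x + 1) ≤ 4 (log x + 1/x) = a + 4/x ≤ a + √(100/(e^{(a+2)/2}+1))
    have hc : (⌈x⌉₊ : ℝ) < x + 1 := Nat.ceil_lt_add_one hx0.le
    have hcpos : (0 : ℝ) < (⌈x⌉₊ : ℝ) := by exact_mod_cast Nat.ceil_pos.mpr hx0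
    have h3 : Real.log (⌈x⌉₊ : ℝ) ≤ Real.log (x + 1) := Real.log_le_log hcpos hc.le
    have h4 : Real.log (x + 1) ≤ Real.log x + 1 / x := by
      have hq : Real.log ((x + 1) / x) ≤ (x + 1) / x - 1 :=
        Real.log_le_sub_one_of_pos (by positivity)
      have hq' : Real.log ((x + 1) / x) = Real.log (x + 1) - Real.log x := by
        rw [Real.log_div (by linarith) hx0.ne']
      have hq'' : (x + 1) / x - 1 = 1 / x := by
        have hxne : x ≠ 0 := hx0.ne'
        field_simp
        ring
      linarith [hq, hq', hq'']
    have h5 : 4 / x ≤ Real.sqrt (100 / (Real.exp ((a + 2) / 2) + 1)) := by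
      have hx2 : x ^ 2 = Real.exp (a / 2) := by
        rw [sq, hx, ← Real.exp_add]; ring_nf
      have hE : Real.exp ((a + 2) / 2) = Real.exp (a / 2) * Real.exp 1 := by
        rw [← Real.exp_add]; ring_nf
      have hE1 : 1 ≤ Real.exp (a / 2) := Real.one_le_exp (by linarith)
      have he : Real.exp 1 < 2.7182818286 := Real.exp_one_lt_d9
      have he0 : 0 < Real.exp 1 := Real.exp_pos 1
      have hsq : (4 / x) ^ 2 ≤ 100 / (Real.exp ((a + 2) / 2) + 1) := by
        rw [div_pow, hx2, hE]
        rw [div_le_div_iff₀ (by positivity) (by positivity)]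
        nlinarith [hE1, he, he0]
      have h4x : 0 ≤ 4 / x := by positivity
      calc 4 / x = Real.sqrt ((4 / x) ^ 2) := (Real.sqrt_sq h4x).symm
        _ ≤ Real.sqrt (100 / (Real.exp ((a + 2) / 2) + 1)) := Real.sqrt_le_sqrt hsq
    have : 4 * Real.log (⌈x⌉₊ : ℝ) ≤ a + 4 / x := by
      have := h3.trans h4
      have h6 : 4 * (Real.log x + 1 / x) = a + 4 / x := by rw [hlogx]; ring
      linarith
    linarith

end Summit.RiemannHypothesis.RiemannHypothesis.Theorems.ScrewQuarticNodes.Folder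
-- ===== END rh-idea-9 QuarticNodesDense.lean =====

namespace Summit.RiemannHypothesis.RiemannHypothesis.Theorems.ScrewQuarticNodes

/-- **Support item `QuarticNodesDense` (stmt-RiemannHypothesis-22171) holds**: for every `a ≥ T₀ = 0` some `j ≥ 1` has
`a ≤ 4 log j ≤ a + √(100/(e^{(a+2)/2}+1))` — by name from `Folder.quarticNodesDense_body` above (the route def unfolds
definitionally). RH-free. -/
theorem quarticNodesDense_proof :
    Summit.RiemannHypothesis.RiemannHypothesis.Theses.ScrewQuarticNodes.QuarticNodesDense :=
  Folder.quarticNodesDense_body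

end Summit.RiemannHypothesis.RiemannHypothesis.Theorems.ScrewQuarticNodes
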